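import Summits.ResolutionOfSingularities.ResolutionOfSingularities.Theorems.FrobeniusClosingSteerSigmaTopLegalityConeDivisor
import Summits.ResolutionOfSingularities.ResolutionOfSingularities.Theorems.FrobeniusClosingSteerPowerSeriesParity
import Summits.ResolutionOfSingularities.ResolutionOfSingularities.Theorems.FrobeniusClosingSteerRadicandCohenFrame
import Literature.AlgebraicGeometry.Resolution.PowerSeriesRegularLocal
import HarnessLib

/-!
# Lemma S kernel, stage (N): odd support of `T`-degree `≥ 2` with `#T < dim` ⇒ the `2`-radicand of a power series is
# NOT isolated; (CD0) for an abstract regular local ring; descent from the completion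

W4.1 support file (crux `Steer`, stmt-ResolutionOfSingularities-16345; line `switching_dichotomy`), res-D-pv-007 AS
res-L0-w41-stub-5, stage (N) of the Lemma S kernel `…NoSatelliteStep` (plan-1 RULINGS 136a/147c; tri-2 audit K1 «(CD0) p529051 is
stated for `R : Subring K`; Lemma S/F apply it in a COMPLETION — an abstract-ring copy (the proof is generic)»):

* `not_hasIsolatedSingularity_of_sub_pow_mem_sq_span_abstract` — (CD0) of `…SigmaTopLegalityConeDivisor` (p529051) copied to
  an ABSTRACT regular local ring `R` of characteristic `p`: `f − hᵖ ∈ (span T)²`, `T ⊆ 𝔪` finite, `#T < dim R` ⇒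
  `¬ HasIsolatedSingularity (RadicandRing R p f)`;
* **`not_hasIsolatedSingularity_of_odd_support`** — in `K⟦X_σ⟧`, `K` perfect of characteristic `2`, `σ` finite: if every ODD
  monomial `m` of `f` (some exponent odd) has `Σ_{t ∈ T} m t ≥ 2` for a set of letters `T` with `#T < #σ`, then
  `RadicandRing K⟦X⟧ 2 f` is NOT isolated (NT-DIRECT §1 (5): `f = ψ² + ι`, `ι ∈ (X_T)²`, via `PowerSeriesParity.
  exists_sub_sq_mem_pow_span_X` p535264, then (CD0) with the `#T` generators `X_t ∈ 𝔪`);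
* **`not_hasIsolatedSingularity_of_adicCompletion`** / **`…_of_ringEquiv_adicCompletion`** — DESCENT: for an excellent
  Noetherian local ring `S` of prime characteristic `p`, if the radicand of `f` read in `Ŝ` (or in any ring `A ≃+* Ŝ`, e.g. the
  Cohen model `K⟦X⟧`) is not isolated, neither is `RadicandRing S p f` (contrapositive of ascent p513029
  `RadicandAscent.isolated_adicCompletion_of_isExcellentRing` + transport p514794 `RadicandCohenFrame.isolated_of_ringEquiv`).

OURS (campaign res-hironaka); nothing here is attributed to [Hironaka2017]. [cite: Matsumura1987, Thm. 14.2; §32 p. 260]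
-/

noncomputable section

-- `Summit.<S>.<S>.…` duplicates the summit name by design (single-problem summit).
set_option linter.dupNamespace false

open Polynomial IsLocalRing MvPowerSeries

namespace Summit.ResolutionOfSingularities.ResolutionOfSingularities.Theorems.SwitchingDichotomy.NoSatelliteStep

open Summit.ResolutionOfSingularities.ResolutionOfSingularities.Theorems.SwitchingDichotomy
open Summit.ResolutionOfSingularities.ResolutionOfSingularities.Theorems.SwitchingDichotomy.SigmaTopLegality
open Literature.AlgebraicGeometry.Resolution

/-! ## (CD0) for an abstract regular local ring -/

/-- **(CD0), abstract ring.** On a regular local ring `R` of characteristic `p` with `dim R = c`: if `f − hᵖ ∈ (span T)²` for a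
finite `T ⊆ 𝔪` with `#T < c`, then `R[X]/(Xᵖ − f)` does NOT have an isolated singularity (verbatim the proof of p529051's
`not_hasIsolatedSingularity_of_sub_pow_mem_sq_span`, which is stated for subrings of a field). OURS.
[cite: Matsumura1987, Thm. 14.2] [folklore] -/
theorem not_hasIsolatedSingularity_of_sub_pow_mem_sq_span_abstract (p : ℕ) [Fact p.Prime]
    {R : Type} [CommRing R] [IsRegularLocalRing R] [CharP R p] (f h : R) (T : Finset R)
    (hT : ∀ t ∈ T, t ∈ maximalIdeal R) (hf : f - h ^ p ∈ Ideal.span (T : Set R) ^ 2)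
    {c : ℕ} (hcard : T.card < c) (hdim : ringKrullDim R = c) :
    ¬ HasIsolatedSingularity (RadicandRing R p f) := by
  intro hiso
  have hle : Ideal.span (T : Set R) ≤ maximalIdeal R :=
    Ideal.span_le.mpr (fun t ht => hT t (by exact_mod_cast ht))
  obtain ⟨Q, hQ, -⟩ := Ideal.exists_minimalPrimes_le hle
  haveI : Q.IsPrime := hQ.1.1
  have hQh : Q.height ≤ T.card := Ideal.height_le_card_of_mem_minimalPrimes_span_finset hQ
  have hne : Q ≠ maximalIdeal R := by
    intro hQm
    rw [hQm] at hQh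
    have hm : ((maximalIdeal R).height : WithBot ℕ∞) = ((c : ℕ∞) : WithBot ℕ∞) := by
      rw [IsLocalRing.maximalIdeal_height_eq_ringKrullDim, hdim]; rfl
    have hm' : (maximalIdeal R).height = (c : ℕ∞) := WithBot.coe_injective hm
    rw [hm'] at hQh
    have : c ≤ T.card := by exact_mod_cast hQh
    omega
  have hnotmax : ¬ Q.IsMaximal := fun hm => hne (IsLocalRing.eq_maximalIdeal hm)
  have hfQ : f - h ^ p ∈ Q ^ 2 := Ideal.pow_right_mono hQ.1.2 2 hf
  haveI : IsRegularRing R := isRegularRing_of_isRegularLocalRing R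
  haveI : IsDomain R := isDomain_of_isRegularLocalRing R
  obtain ⟨P', hP', hlt, hreg⟩ :=
    RadicandChain.exists_nonmaximal_not_isRegularLocalRing_of_sub_pow_mem_sq (S := R) p f h Q hnotmax hfQ
  exact hreg (hiso P' hlt)

/-! ## Odd support in `(X_T)²` ⇒ not isolated, in `K⟦X⟧` -/

/-- **NT-DIRECT §1 (5) in the kernel.** In `K⟦X_σ⟧` (`K` perfect of characteristic `2`, `σ` finite): if every ODD monomial of `f`
has `T`-degree `≥ 2` for a set of letters `T` with `#T < #σ`, then the `2`-radicand `K⟦X⟧[U]/(U² − f)` is NOT isolated.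
OURS. [cite: Matsumura1987, Thm. 14.2] [folklore] -/
theorem not_hasIsolatedSingularity_of_odd_support {σ : Type} [Fintype σ] [DecidableEq σ] {K : Type} [Field K] [CharP K 2]
    [PerfectRing K 2] (T : Finset σ) (hT : T.card < Fintype.card σ) (f : MvPowerSeries σ K)
    (h : ∀ m : σ →₀ ℕ, (∃ i, Odd (m i)) → coeff m f ≠ 0 → 2 ≤ ∑ t ∈ T, m t) :
    ¬ HasIsolatedSingularity (RadicandRing (MvPowerSeries σ K) 2 f) := by
  classical
  haveI : Fact (Nat.Prime 2) := ⟨Nat.prime_two⟩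
  haveI : IsRegularLocalRing (MvPowerSeries σ K) := isRegularLocalRing_mvPowerSeries K σ
  haveI : CharP (MvPowerSeries σ K) 2 := charP_of_injective_algebraMap (C_injective (σ := σ) (R := K)) 2
  obtain ⟨ψ, hψ⟩ := PowerSeriesParity.exists_sub_sq_mem_pow_span_X T 2 f h
  have hspan : Ideal.span ((fun s : σ => (X s : MvPowerSeries σ K)) '' (T : Set σ)) =
      Ideal.span ((T.image fun s : σ => (X s : MvPowerSeries σ K) : Finset (MvPowerSeries σ K)) :
        Set (MvPowerSeries σ K)) := by
    rw [Finset.coe_image]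
  rw [hspan] at hψ
  refine not_hasIsolatedSingularity_of_sub_pow_mem_sq_span_abstract 2 f ψ _ (fun t ht => ?_) hψ
    (lt_of_le_of_lt Finset.card_image_le hT) ?_
  · obtain ⟨s, -, rfl⟩ := Finset.mem_image.mp ht
    exact X_mem_maximalIdeal K σ s
  · rw [ringKrullDim_mvPowerSeries, Nat.card_eq_fintype_card]

/-! ## Descent from the completion -/

/-- **Descent of non-isolatedness from the completion** (excellent Noetherian local ring of prime characteristic `p`): if the
radicand of `f` read in `Ŝ` is not isolated, neither is the radicand of `f` over `S`. OURS. [cite: Matsumura1987, §32 p. 260] -/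
theorem not_hasIsolatedSingularity_of_adicCompletion (p : ℕ) [Fact p.Prime] {S : Type} [CommRing S] [IsLocalRing S]
    [IsNoetherianRing S] [CharP S p] (hexc : IsExcellentRing S) (f : S)
    (h : ¬ HasIsolatedSingularity (RadicandRing (AdicCompletion (maximalIdeal S) S) p
      (algebraMap S (AdicCompletion (maximalIdeal S) S) f))) :
    ¬ HasIsolatedSingularity (RadicandRing S p f) := fun hiso =>
  h fun Q' _ hQ' => RadicandAscent.isolated_adicCompletion_of_isExcellentRing p f hexc hiso Q' hQ'

/-- **Descent through a model of the completion** (e.g. the Cohen isomorphism `Ŝ ≃+* K⟦X⟧`): if `φ : Ŝ ≃+* A` and the radicand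
of `φ f̂` over `A` is not isolated, then the radicand of `f` over `S` is not isolated. OURS. [cite: Matsumura1987, §32 p. 260] -/
theorem not_hasIsolatedSingularity_of_ringEquiv_adicCompletion (p : ℕ) [Fact p.Prime] {S : Type} [CommRing S]
    [IsLocalRing S] [IsNoetherianRing S] [CharP S p] (hexc : IsExcellentRing S) (f : S) {A : Type} [CommRing A]
    (φ : AdicCompletion (maximalIdeal S) S ≃+* A)
    (h : ¬ HasIsolatedSingularity (RadicandRing A p (φ (algebraMap S (AdicCompletion (maximalIdeal S) S) f)))) :
    ¬ HasIsolatedSingularity (RadicandRing S p f) := by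
  refine not_hasIsolatedSingularity_of_adicCompletion p hexc f fun hiso => h fun Q' _ hQ' => ?_
  exact RadicandCohenFrame.isolated_of_ringEquiv p φ _ hiso Q' hQ'

end Summit.ResolutionOfSingularities.ResolutionOfSingularities.Theorems.SwitchingDichotomy.NoSatelliteStep

end
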